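import Literature.NumberTheory.LFunctions.Zhang2022.KnifeEdgeLenSiegelDominate

/-!
# Zhang (2022), rung F-S3 (Landau–Siegel programme, §D edge len = E*-len⁺): card `siegel-model-family-index`
# (ls-knife-len-idea-2) — the SLOT ALGEBRA of the Siegel family's discrete mean (scaling, polarisation, two-piece
# split; exact) and the PROVED composition «three Siegel slots ⇒ Siegel whole-design row ⇒ (one-sided) Theorem 1»

Y. Zhang, *Discrete mean estimates and the Landau–Siegel zero*, arXiv:2211.02515v1 [Zhang2022LandauSiegel] —
an unrefereed manuscript under adjudication; T. Tao, J. Teräväinen [TaoTeravainen2021] (the Siegel model).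
**WHAT THIS IS NOT: not a claim about Theorems 1–2 of arXiv:2211.02515, about Landau–Siegel zeros, or about
Parity. The programme SEARCHES and TYPES; no claim about Landau–Siegel zeros, Theorems 1–2 of arXiv:2211.02515 or a
repaired Margin232 until a kernel theorem says so. Every `theorem` here is exact finite algebra of the Siegel family's
discrete mean (`KnifeEdgeLenSiegelFamily`) or an implication between the bare `Prop`s of `KnifeEdgeLenSiegelSlots` /
`KnifeEdgeLenSiegelDominate` (OPEN, asserted by no one) and the skeleton's CLAIMS `Prop22i`, `Lemma23`.**

WHY. After the critic's ruling (ls-knife-crit-1 2026-08-26T22:31:36Z) the card's cruxes are «K2-CIS-upper» — the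
Siegel family's SLOTS (`SiegelInClassMean`, `SiegelCrossMean`, `SiegelOverhangMean`, bare Props of
`KnifeEdgeLenSiegelSlots`) — and K3 (closing); the one-sided endgame `theorem1_of_siegel_dominate`
(`KnifeEdgeLenSiegelDominate`) consumes the Siegel family's WHOLE-DESIGN row `SiegelEStarLenPlusShape`. This file
supplies the missing composition on the Siegel side, the analogue of `KnifeEdge.eStarLenPlusShape_of_slots` for
Zhang's prime family (`KnifeEdgeSlotCalculus`):

* Part 1 (exact algebra, every modulus). Per-modulus slices and the Siegel mean/polar form are a weighted sesquilinear
  calculus: `modMean_add` / `discMeanS_add` (polarisation `Ξ_S(F+G) = Ξ_S(F) + Ξ_S(G) + 2Re Ξ_S(F,G)`), `modMean_smul` /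
  `discMeanS_smul` (`Ξ_S(a·F) = |a|²Ξ_S(F)`), `modPolar_smul_left` / `discPolarS_smul_left`.
* Part 2 (exact, pointwise in `(ψ, s)`). The two-piece split of the Siegel family's profile polynomial at the wall:
  `profPolyS_eq_add_blockPolyS`, `profPolyS_congr`, `blockPolyS_congr`, `profPolyS_twoPiece`
  (`s·u ⊕ v` of length `N ≥ ⌈P⌉` = `s·(poly of u, length ⌈P⌉) + (block of v from ⌈P⌉)`), `profPolyS_ceil_eq_floor_succ`.
* Part 3 (PROVED compositions). `siegelEStarLenPlusShape_of_slots : 1 ≤ θ → (𝒱 vanishes below the wall) →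
  SiegelInClassMean c' ψc → SiegelCrossMean c' ψc θ X 𝒱 → SiegelOverhangMean c' ψc θ X 𝒱 →
  SiegelEStarLenPlusShape c' ψc θ X 𝒱`, and the one-sided line from the SLOTS: `theorem1_of_siegel_slots`
  (three Siegel slots ∧ `SiegelWeightsNonneg` ∧ `ClosesByPositivityIn` ∧ `Prop22i` ∧ `Lemma23` ⇒ `Theorem1`) — no
  transfer identity K1, no sup/avg hypothesis (cf. `theorem1_of_siegel_dominate`).

Typer: ls-knife-typer-1 (cell landau-siegel §D). Pinned scales (`P = exp 𝓛⁹`).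

## References
* Y. Zhang, arXiv:2211.02515v1 (2022), §2 (2.16)–(2.17), (2.23), (2.30); §7 Prop 7.1 (7.2); §8 (8.3)–(8.5), (8.23).
  [cite: Zhang2022LandauSiegel, §2, §7, §8]
* T. Tao, J. Teräväinen, arXiv:2109.06291, §5. [cite: TaoTeravainen2021, §5]
-/

noncomputable section

open Finset Real Complex ComplexConjugate

namespace Literature.NumberTheory.LFunctions.Zhang2022.KnifeEdge

open Skeleton Repair
open Literature.Barriers.Parity.TaoTeravainen (IsSmoothCutoff)

variable {D : ℕ}

/-! ### Part 1 — scaling and polarisation of the Siegel family's discrete mean (exact, every modulus) -/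

section Algebra

variable {c' : ℝ} {χ : DirichletCharacter ℂ D} {ψc : ℝ → ℝ}

/-- Polarisation at one modulus: `slice(F+G) = slice(F) + slice(G) + 2Re slice(F,G)`.
[cite: Zhang2022LandauSiegel, §2 (2.16)–(2.17)] -/
theorem modMean_add (F G : SChr D → ℂ → ℂ) (k : ℕ) :
    modMean c' χ (fun y t => F y t + G y t) k = modMean c' χ F k + modMean c' χ G k + 2 * (modPolar c' χ F G k).re := by
  unfold modMean modPolar
  rw [Complex.re_sum, Finset.mul_sum, ← Finset.sum_add_distrib, ← Finset.sum_add_distrib]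
  refine Finset.sum_congr rfl fun y _ => ?_
  rw [Complex.re_sum, Finset.mul_sum, ← Finset.sum_add_distrib, ← Finset.sum_add_distrib]
  refine Finset.sum_congr rfl fun ρ _ => ?_
  rw [Complex.re_ofReal_mul, Complex.sq_norm, Complex.sq_norm, Complex.sq_norm, Complex.normSq_add]
  ring

/-- Scaling at one modulus: `slice(a·F) = |a|²·slice(F)`. [cite: Zhang2022LandauSiegel, §2 (2.16)] -/
theorem modMean_smul (a : ℂ) (F : SChr D → ℂ → ℂ) (k : ℕ) :
    modMean c' χ (a • F) k = ‖a‖ ^ 2 * modMean c' χ F k := by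
  unfold modMean
  simp only [Pi.smul_apply, smul_eq_mul]
  rw [Finset.mul_sum]
  refine Finset.sum_congr rfl fun y _ => ?_
  rw [Finset.mul_sum]
  refine Finset.sum_congr rfl fun ρ _ => ?_
  rw [norm_mul, mul_pow]
  ring

/-- Scaling of the polar slice in the first table: `slice(a·F, G) = a·slice(F,G)`. [cite: Zhang2022LandauSiegel, §2 (2.17)] -/
theorem modPolar_smul_left (a : ℂ) (F G : SChr D → ℂ → ℂ) (k : ℕ) :
    modPolar c' χ (a • F) G k = a * modPolar c' χ F G k := by
  unfold modPolar
  simp only [Pi.smul_apply, smul_eq_mul]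
  rw [Finset.mul_sum]
  refine Finset.sum_congr rfl fun y _ => ?_
  rw [Finset.mul_sum]
  refine Finset.sum_congr rfl fun ρ _ => ?_
  ring

/-- **Polarisation of the Siegel mean:** `Ξ_S(F+G) = Ξ_S(F) + Ξ_S(G) + 2Re Ξ_S(F,G)` (weights `w(m)` real).
[cite: Zhang2022LandauSiegel, §2 (2.16)–(2.17); TaoTeravainen2021, §5] -/
theorem discMeanS_add (F G : SChr D → ℂ → ℂ) :
    discMeanS c' χ ψc (fun y t => F y t + G y t)
      = discMeanS c' χ ψc F + discMeanS c' χ ψc G + 2 * (discPolarS c' χ ψc F G).re := by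
  unfold discMeanS discPolarS
  rw [Complex.re_sum, Finset.mul_sum, ← Finset.sum_add_distrib, ← Finset.sum_add_distrib]
  refine Finset.sum_congr rfl fun m _ => ?_
  rw [modMean_add, Complex.re_ofReal_mul]
  ring

/-- **Scaling of the Siegel mean:** `Ξ_S(a·F) = |a|²·Ξ_S(F)`. [cite: Zhang2022LandauSiegel, §2 (2.16)] -/
theorem discMeanS_smul (a : ℂ) (F : SChr D → ℂ → ℂ) :
    discMeanS c' χ ψc (a • F) = ‖a‖ ^ 2 * discMeanS c' χ ψc F := by
  unfold discMeanS
  rw [Finset.mul_sum]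
  refine Finset.sum_congr rfl fun m _ => ?_
  rw [modMean_smul]
  ring

/-- **Scaling of the Siegel polar form in the first table:** `Ξ_S(a·F, G) = a·Ξ_S(F,G)`. [cite: Zhang2022LandauSiegel, §2 (2.17)] -/
theorem discPolarS_smul_left (a : ℂ) (F G : SChr D → ℂ → ℂ) :
    discPolarS c' χ ψc (a • F) G = a * discPolarS c' χ ψc F G := by
  unfold discPolarS
  rw [Finset.mul_sum]
  refine Finset.sum_congr rfl fun m _ => ?_
  rw [modPolar_smul_left]
  ring

end Algebra

/-! ### Part 2 — the two-piece split of the Siegel family's profile polynomial at the wall (pointwise identities) -/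

section Splits

variable (χ : DirichletCharacter ℂ D) (y : SChr D)

/-- A Siegel-family profile polynomial splits at any intermediate length into a shorter one plus a block.
[cite: Zhang2022LandauSiegel, §2 (2.23), (2.30)] -/
theorem profPolyS_eq_add_blockPolyS {M N : ℕ} (hM : 1 ≤ M) (hMN : M ≤ N) (𝔤 : ℝ → ℂ) (s : ℂ) :
    profPolyS χ y 𝔤 N s = profPolyS χ y 𝔤 M s + blockPolyS χ y M N 𝔤 s := by
  unfold profPolyS blockPolyS
  rw [← Finset.sum_Ico_consecutive _ hM hMN]

/-- Profile polynomials of profiles agreeing at the samples `1 ≤ n < N` coincide. [cite: Zhang2022LandauSiegel, §2 (2.23)] -/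
theorem profPolyS_congr {𝔤₁ 𝔤₂ : ℝ → ℂ} {N : ℕ} (s : ℂ)
    (h : ∀ n : ℕ, 1 ≤ n → n < N → 𝔤₁ (Real.log n / Real.log (bigP D)) = 𝔤₂ (Real.log n / Real.log (bigP D))) :
    profPolyS χ y 𝔤₁ N s = profPolyS χ y 𝔤₂ N s := by
  unfold profPolyS
  refine Finset.sum_congr rfl fun n hn => ?_
  rw [Finset.mem_Ico] at hn
  rw [h n hn.1 hn.2]

/-- Blocks of profiles agreeing at the samples `M ≤ n < N` coincide. [cite: Zhang2022LandauSiegel, §2 (2.23), (2.30)] -/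
theorem blockPolyS_congr {𝔤₁ 𝔤₂ : ℝ → ℂ} {M N : ℕ} (s : ℂ)
    (h : ∀ n : ℕ, M ≤ n → n < N → 𝔤₁ (Real.log n / Real.log (bigP D)) = 𝔤₂ (Real.log n / Real.log (bigP D))) :
    blockPolyS χ y M N 𝔤₁ s = blockPolyS χ y M N 𝔤₂ s := by
  unfold blockPolyS
  refine Finset.sum_congr rfl fun n hn => ?_
  rw [Finset.mem_Ico] at hn
  rw [h n hn.1 hn.2]

/-- **The two-piece split on the Siegel family.** For `u` vanishing on `[1,∞)` and `v` vanishing below `1`, the profile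
polynomial of `s·u + v` of any length `N ≥ ⌈P⌉` is `s·(polynomial of u of length ⌈P⌉) + (block of v from ⌈P⌉ to N)`,
pointwise in `(ψ, s)` at EVERY modulus — the formula of `KnifeEdge.profPoly_twoPiece`. [cite: Zhang2022LandauSiegel, §7 (7.2), §2 (2.30)] -/
theorem profPolyS_twoPiece (hP : 1 < bigP D) {u v : ℝ → ℂ} (hu : ∀ z, 1 ≤ z → u z = 0)
    (hv : ∀ z, z < 1 → v z = 0) (s : ℂ) {N : ℕ} (hN : ⌈bigP D⌉₊ ≤ N) (t : ℂ) :
    profPolyS χ y (fun z => s * u z + v z) N t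
      = s * profPolyS χ y u ⌈bigP D⌉₊ t + blockPolyS χ y ⌈bigP D⌉₊ N v t := by
  rw [profPolyS_eq_add_blockPolyS χ y (one_le_ceil_bigP hP) hN]
  congr 1
  · unfold profPolyS
    rw [Finset.mul_sum]
    refine Finset.sum_congr rfl fun n hn => ?_
    rw [Finset.mem_Ico] at hn
    dsimp only
    rw [hv _ (logRatio_lt_one_of_lt_ceil hP hn.1 hn.2), add_zero]
    ring
  · refine blockPolyS_congr χ y t fun n hM _ => ?_
    rw [hu _ (one_le_logRatio_of_ceil_le hP hM), mul_zero, zero_add]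

/-- For a piece vanishing on `[1,∞)` the lengths `⌈P⌉` and `⌊P⌋+1` give the same Siegel-family polynomial.
[cite: Zhang2022LandauSiegel, §7 (7.2)] -/
theorem profPolyS_ceil_eq_floor_succ (hP : 1 < bigP D) {u : ℝ → ℂ} (hu : ∀ z, 1 ≤ z → u z = 0) (t : ℂ) :
    profPolyS χ y u ⌈bigP D⌉₊ t = profPolyS χ y u (⌊bigP D⌋₊ + 1) t := by
  rw [profPolyS_eq_add_blockPolyS χ y (one_le_ceil_bigP hP) (Nat.ceil_le_floor_add_one _)]
  suffices hb : blockPolyS χ y ⌈bigP D⌉₊ (⌊bigP D⌋₊ + 1) u t = 0 by rw [hb, add_zero]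
  refine Finset.sum_eq_zero fun n hn => ?_
  rw [Finset.mem_Ico] at hn
  rw [hu _ (one_le_logRatio_of_ceil_le hP hn.1), mul_zero, zero_mul]

end Splits

/-! ### Part 3 — the Siegel slots compose into the Siegel whole-design row, hence into the one-sided endgame (proved) -/

section Compose

variable {c' : ℝ} {ψc : ℝ → ℝ}

/-- ε-bookkeeping for a design with amplitude `s`: slot errors at `δ = ε/(3(|s|+1)²)` add up to `≤ ε`
(`(|s|² + 2|s| + 1)δ = ε/3`); copy of the private helper of `KnifeEdgeSlotCalculus`. [folklore] -/
private theorem twoPiece_error_bound' {ε 𝔞 𝔓 A B a k : ℝ} {s C c : ℂ} (hε : 0 < ε) (h𝔞 : 0 ≤ 𝔞) (h𝔓 : 0 ≤ 𝔓)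
    (h1 : |A - a * 𝔞 * 𝔓| ≤ ε / (3 * (‖s‖ + 1) ^ 2) * 𝔞 * 𝔓)
    (h2 : ‖C - c * 𝔞 * 𝔓‖ ≤ ε / (3 * (‖s‖ + 1) ^ 2) * 𝔞 * 𝔓)
    (h3 : |B - k * 𝔞 * 𝔓| ≤ ε / (3 * (‖s‖ + 1) ^ 2) * 𝔞 * 𝔓) :
    |‖s‖ ^ 2 * A + B + 2 * (s * C).re - (a * ‖s‖ ^ 2 + 2 * (s * c).re + k) * 𝔞 * 𝔓| ≤ ε * 𝔞 * 𝔓 := by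
  set δ : ℝ := ε / (3 * (‖s‖ + 1) ^ 2) with hδ
  set X : ℝ := 𝔞 * 𝔓 with hX
  have hX0 : 0 ≤ X := mul_nonneg h𝔞 h𝔓
  have hs : 0 ≤ ‖s‖ := norm_nonneg s
  have h1' : |A - a * X| ≤ δ * X := by rw [hX, ← mul_assoc, ← mul_assoc]; exact h1
  have h3' : |B - k * X| ≤ δ * X := by rw [hX, ← mul_assoc, ← mul_assoc]; exact h3
  have h2X : ‖C - c * (X : ℂ)‖ ≤ δ * X := by
    rw [show c * (X : ℂ) = c * 𝔞 * 𝔓 by rw [hX]; push_cast; ring, hX, ← mul_assoc]; exact h2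
  have hre : (s * (C - c * (X : ℂ))).re = (s * C).re - (s * c).re * X := by
    rw [mul_sub, Complex.sub_re, ← mul_assoc, Complex.re_mul_ofReal]
  have h2' : |(s * C).re - (s * c).re * X| ≤ ‖s‖ * (δ * X) := by
    rw [← hre]
    calc |(s * (C - c * (X : ℂ))).re| ≤ ‖s * (C - c * (X : ℂ))‖ := Complex.abs_re_le_norm _
      _ = ‖s‖ * ‖C - c * (X : ℂ)‖ := norm_mul _ _
      _ ≤ ‖s‖ * (δ * X) := mul_le_mul_of_nonneg_left h2X hs
  have key : ‖s‖ ^ 2 * A + B + 2 * (s * C).re - (a * ‖s‖ ^ 2 + 2 * (s * c).re + k) * 𝔞 * 𝔓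
      = ‖s‖ ^ 2 * (A - a * X) + 2 * ((s * C).re - (s * c).re * X) + (B - k * X) := by
    rw [hX]; ring
  rw [key]
  have hA : |‖s‖ ^ 2 * (A - a * X)| ≤ ‖s‖ ^ 2 * (δ * X) := by
    rw [abs_mul, abs_of_nonneg (by positivity : (0:ℝ) ≤ ‖s‖ ^ 2)]
    exact mul_le_mul_of_nonneg_left h1' (by positivity)
  have hB : |2 * ((s * C).re - (s * c).re * X)| ≤ 2 * (‖s‖ * (δ * X)) := by
    rw [abs_mul, abs_two]; exact mul_le_mul_of_nonneg_left h2' (by norm_num)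
  have hsum : (‖s‖ ^ 2 + 2 * ‖s‖ + 1) * δ = ε / 3 := by
    have h0 : (‖s‖ + 1) ^ 2 ≠ 0 := by positivity
    rw [hδ]; field_simp; ring
  calc |‖s‖ ^ 2 * (A - a * X) + 2 * ((s * C).re - (s * c).re * X) + (B - k * X)|
      ≤ |‖s‖ ^ 2 * (A - a * X)| + |2 * ((s * C).re - (s * c).re * X)| + |B - k * X| := abs_add_three _ _ _
    _ ≤ ‖s‖ ^ 2 * (δ * X) + 2 * (‖s‖ * (δ * X)) + δ * X := by linarith
    _ = (‖s‖ ^ 2 + 2 * ‖s‖ + 1) * δ * X := by ring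
    _ = ε / 3 * X := by rw [hsum]
    _ ≤ ε * X := by nlinarith
    _ = ε * 𝔞 * 𝔓 := by rw [hX, mul_assoc]

/-- **COMPOSITION ON THE SIEGEL SIDE (proved): the three Siegel slots give the Siegel whole-design row.** If
`SiegelInClassMean c' ψc`, `SiegelCrossMean c' ψc θ X 𝒱` and `SiegelOverhangMean c' ψc θ X 𝒱` hold and the pieces
of `𝒱` vanish below the wall, then `SiegelEStarLenPlusShape c' ψc θ X 𝒱` for every `θ ≥ 1`: the Siegel mean of
`s·u ⊕ v` is the sum of its blocks EXACTLY (`profPolyS_twoPiece`, `discMeanS_add`, `discMeanS_smul`,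
`discPolarS_smul_left`) and `twoPieceMainTerm = |s|²𝔅(u) + 2Re(s·crossCoeff) + overhangConst`. All three slots are
OPEN; nothing asserted. [cite: Zhang2022LandauSiegel, §7 Prop 7.1 (7.2), §8 (8.3)–(8.5), (8.23); TaoTeravainen2021, §5] -/
theorem siegelEStarLenPlusShape_of_slots {θ : ℝ} (hθ : 1 ≤ θ) {X : PairFunctional}
    {𝒱 : (ℝ → ℂ) → (ℝ → ℂ) → Prop} (h𝒱 : ∀ v v', 𝒱 v v' → ∀ z, z < 1 → v z = 0)
    (hB : SiegelInClassMean c' ψc) (hC : SiegelCrossMean c' ψc θ X 𝒱) (hO : SiegelOverhangMean c' ψc θ X 𝒱) :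
    SiegelEStarLenPlusShape c' ψc θ X 𝒱 := by
  intro u u' v v' s hu hv ε hε
  have hδ : 0 < ε / (3 * (‖s‖ + 1) ^ 2) := by positivity
  have hev := (((hB u u' hu.kinked _ hδ).and (hC u u' v v' hu hv _ hδ)).and (hO v v' hv _ hδ)).and
    eventually_one_lt_bigP
  refine hev.mono fun D _ χ hq _ h hA => ?_
  obtain ⟨⟨⟨h1, h2⟩, h3⟩, hP⟩ := h
  have hN : ⌈bigP D⌉₊ ≤ ⌈bigP D ^ θ⌉₊ := Nat.ceil_le_ceil (Real.self_le_rpow_of_one_le hP.le hθ)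
  set F : SChr D → ℂ → ℂ := fun y t => profPolyS χ y u (⌊bigP D⌋₊ + 1) t with hF
  set G : SChr D → ℂ → ℂ := fun y t => blockPolyS χ y ⌈bigP D⌉₊ ⌈bigP D ^ θ⌉₊ v t with hG
  have hsplit : (fun y t => profPolyS χ y (fun z => s * u z + v z) ⌈bigP D ^ θ⌉₊ t)
      = fun y t => (s • F) y t + G y t := by
    funext y t
    simp only [Pi.smul_apply, smul_eq_mul, hF, hG]
    rw [profPolyS_twoPiece χ y hP hu.vanish (h𝒱 v v' hv) s hN, profPolyS_ceil_eq_floor_succ χ y hP hu.vanish]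
  rw [hsplit, discMeanS_add, discMeanS_smul, discPolarS_smul_left, twoPieceMainTerm_eq]
  exact twoPiece_error_bound' hε (frakA_nonneg χ) (frakPS_nonneg χ ψc hq) (h1 hA) (h2 hA) (h3 hA)

/-- **THE ONE-SIDED LINE FROM THE SLOTS (proved): the three Siegel slots (the card's K2-CIS objects) ∧ nonneg weights
on the Siegel family ∧ a closing design (K3) ∧ Prop. 2.2 (i) ∧ Lemma 2.3 ⇒ Theorem 1** — `siegelEStarLenPlusShape_of_slots`
then `theorem1_of_siegel_dominate`; no transfer identity K1 and no sup/avg hypothesis. Every hypothesis OPEN / a CLAIM;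
nothing asserted. [cite: Zhang2022LandauSiegel, §2 p.6, §7 Prop 7.1 (7.2), §8 (8.3)–(8.5); TaoTeravainen2021, §5] -/
theorem theorem1_of_siegel_slots {θ : ℝ} (hθ : 1 ≤ θ) {X : PairFunctional} {𝒱 : (ℝ → ℂ) → (ℝ → ℂ) → Prop}
    (h𝒱 : ∀ v v', 𝒱 v v' → ∀ z, z < 1 → v z = 0) (hW : SiegelWeightsNonneg c') (hψ : IsSmoothCutoff ψc)
    (hB : SiegelInClassMean c' ψc) (hC : SiegelCrossMean c' ψc θ X 𝒱) (hO : SiegelOverhangMean c' ψc θ X 𝒱)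
    (hK : ClosesByPositivityIn θ X 𝒱) (h22 : Prop22i) (h23 : Lemma23 c') : Theorem1 :=
  theorem1_of_siegel_dominate hW hψ (siegelEStarLenPlusShape_of_slots hθ h𝒱 hB hC hO) hK h22 h23

/-- … and Theorem 2. [cite: Zhang2022LandauSiegel, §1 Theorem 2] -/
theorem theorem2_of_siegel_slots {θ : ℝ} (hθ : 1 ≤ θ) {X : PairFunctional} {𝒱 : (ℝ → ℂ) → (ℝ → ℂ) → Prop}
    (h𝒱 : ∀ v v', 𝒱 v v' → ∀ z, z < 1 → v z = 0) (hW : SiegelWeightsNonneg c') (hψ : IsSmoothCutoff ψc)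
    (hB : SiegelInClassMean c' ψc) (hC : SiegelCrossMean c' ψc θ X 𝒱) (hO : SiegelOverhangMean c' ψc θ X 𝒱)
    (hK : ClosesByPositivityIn θ X 𝒱) (h22 : Prop22i) (h23 : Lemma23 c') : Theorem2 :=
  Skeleton.theorem2_of_theorem1 (theorem1_of_siegel_slots hθ h𝒱 hW hψ hB hC hO hK h22 h23)

end Compose

end Literature.NumberTheory.LFunctions.Zhang2022.KnifeEdge

end
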